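import Mathlib
import HarnessLib
import Summits.HubbardSuperconductivity.HubbardSuperconductivity.Theorems.WeakCouplingBCSKlLindhardEnclosureTipVariants

/-!
# KL-MARGIN-SCAN reader (22) «kernel-lindhard-enclosure» — **THE TIP RULE IS SOUND**: `ceilTipSoundOrd : ∀ P, CeilTipSoundOrd P` (seat p4 g25)

Unpacking of `Params.ceilTip` (`…LindhardEnclosureKernel` §3b): four certified cosine directions, `hints ∧ guards`, `0 < J0`, and
`u = min` over the available `tipVariant`s (each `< 2^200`); every available variant is a valid ceiling by `Params.tip_valid_outer_x/_outer_y`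
(`…TipVariants`) instantiated at `(ε_p − μ, ε_{p+q} − μ)` or its swap with the cell data of `…TipSlices` and the cross-slice package
`Params.tip_cell_package` (`…Tip`); minima of valid ceilings are valid (`ceilValid_min`).  With p1 g26's `ceilChordSoundOrd`, `floorInsideSoundOrd`
and the boundary rules this discharges one of the three curved-cell hypotheses of `sound_of_five_rulesOrd` / `W20_enclosure_of_five_rulesOrd`.
Honest framing: instrument soundness; nothing here asserts a margin at `t′ ≠ 0`, a channel order, `K₃`, `U₀`, the window or superconductivity;
a Kohn–Luttinger `O(U²)` channel statement is not ODLRO.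
References: idea-4 r11 Core §3b/§5 (tree: `…LindhardEnclosureKernel`, `…LindhardEnclosureGate`).
-/

noncomputable section

set_option linter.dupNamespace false

namespace Summit.HubbardSuperconductivity.HubbardSuperconductivity.Theorems.KlLindhardEnclosure

open Real Set MeasureTheory Literature.MathematicalPhysics.QuantumLattice

/-- Bookkeeping for the kernel's `pick`: if `w` is a valid ceiling and `X` is either the sentinel `big` or a valid ceiling, then so is `min w X`. [folklore] -/
theorem Params.ceilValid_min_or (P : Params) {a b c d w X big : ℤ} (hw : P.CeilValid a b c d w) (hX : X = big ∨ P.CeilValid a b c d X) :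
    min w X = big ∨ P.CeilValid a b c d (min w X) := by
  rcases min_choice w X with h | h <;> rw [h]
  · exact Or.inr hw
  · exact hX

set_option maxHeartbeats 800000 in
/-- **THE TIP RULE IS SOUND for every parameter set `P`.** [folklore] -/
theorem ceilTipSoundOrd (P : Params) : CeilTipSoundOrd P := by
  intro a b c d τx σx τy σy τx' σx' τy' σy' u hP hin hab hcd hg _hs1 _hs2 h
  obtain ⟨htpD, hmuD, hU, -, -⟩ := P.admissible_facts hP
  have hU' : (0 : ℝ) < (P.U : ℝ) := by exact_mod_cast hU
  set C := P.cell (P.mkX a) (P.mkX b) (P.mkY c) (P.mkY d) with hC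
  -- unpack the kernel
  unfold Params.ceilTip at h
  simp only [Params.mkX_z, Params.mkY_z] at h
  rcases hdx : P.cosDirZ a b with _ | dx <;> rcases hdy : P.cosDirZ c d with _ | dy <;>
    rcases hdx' : P.cosDirZ (a + P.q1z) (b + P.q1z) with _ | dx' <;> rcases hdy' : P.cosDirZ (c + P.q2z) (d + P.q2z) with _ | dy' <;>
    simp only [hdx, hdy, hdx', hdy'] at h <;> try exact absurd h.symm (Option.some_ne_none u)
  -- the main branch
  split_ifs at h with hhg hJ0 hbest
  simp only [Option.some.injEq] at h
  simp only [Bool.and_eq_true] at hhg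
  obtain ⟨⟨⟨⟨⟨⟨⟨⟨h1, h2⟩, h3⟩, h4⟩, h5⟩, h6⟩, h7⟩, h8⟩, -⟩ := hhg
  -- names
  set X1 := P.derivIV dx τx σx C.bLo C.bUp with hX1
  set Y1 := P.derivIV dy τy σy C.aLo C.aUp with hY1
  set X2 := P.derivIV dx' τx' σx' C.bLo' C.bUp' with hX2
  set Y2 := P.derivIV dy' τy' σy' C.aLo' C.aUp' with hY2
  set J0 := ((X1.mul Y2).sub (Y1.mul X2)).absLo with hJ0def
  set Lmax : ℤ := 2 * 10 ^ 4 * (D + cdivZ (2 * |P.tpN| * D) P.tpD) with hLdef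
  set U1 := P.distHiZ C.e1Lo C.e1Hi with hU1
  set U2 := P.distHiZ C.e2Lo C.e2Hi with hU2
  have hL : 0 < Lmax := P.Lmax_pos htpD
  -- the cross-slice package
  obtain ⟨x', hx', y', hy', hpk⟩ := P.tip_cell_package hP hin hab hcd C hC hg hdx hdy hdx' hdy' h1 h2 h3 h4 h5 h6 h7 h8
  have hκeq : ((J0 : ℤ) : ℝ) / (10 ^ 4 * 2 ^ 40) ^ 2 / (2 * (((Lmax : ℤ) : ℝ) / (10 ^ 4 * 2 ^ 40))) =
      ((J0 : ℤ) : ℝ) / (2 * (10 ^ 4 * 2 ^ 40) * ((Lmax : ℤ) : ℝ)) := by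
    have hL' : ((Lmax : ℤ) : ℝ) ≠ 0 := by exact_mod_cast hL.ne'
    field_simp
  -- the two energies as explicit functions
  set t : ℝ := (P.tpN : ℝ) / (P.tpD : ℝ) with ht
  set μ : ℝ := (P.muN : ℝ) / (P.muD : ℝ) with hμ
  set q₁ : ℝ := (P.q1z : ℝ) / (P.U : ℝ) with hq₁
  set q₂ : ℝ := (P.q2z : ℝ) / (P.U : ℝ) with hq₂
  set f : ℝ → ℝ → ℝ := fun x y => -2 * (Real.cos x + Real.cos y) - 4 * t * Real.cos x * Real.cos y - μ with hf
  set g : ℝ → ℝ → ℝ := fun x y => -2 * (Real.cos (x + q₁) + Real.cos (y + q₂)) - 4 * t * Real.cos (x + q₁) * Real.cos (y + q₂) - μ with hgd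
  have hfe : ∀ x y, P.band (pt x y) - μ = f x y := fun x y => by rw [P.tip_band_pt]
  have hge : ∀ x y, P.band (pt x y + P.qv) - μ = g x y := fun x y => by rw [P.tip_band_pt_shift]
  have hfx : ∀ x y, HasDerivAt (fun s => f s y) (2 * Real.sin x * (1 + 2 * t * Real.cos y)) x := fun x y => by
    simpa only [add_zero] using hasDerivAt_bandFun_fst t μ 0 0 y x
  have hfy : ∀ x y, HasDerivAt (fun s => f x s) (2 * Real.sin y * (1 + 2 * t * Real.cos x)) y := fun x y => by
    simpa only [add_zero] using hasDerivAt_bandFun_snd t μ 0 0 x y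
  have hgx : ∀ x y, HasDerivAt (fun s => g s y) (2 * Real.sin (x + q₁) * (1 + 2 * t * Real.cos (y + q₂))) x :=
    fun x y => hasDerivAt_bandFun_fst t μ q₁ q₂ y x
  have hgy : ∀ x y, HasDerivAt (fun s => g x s) (2 * Real.sin (y + q₂) * (1 + 2 * t * Real.cos (x + q₁))) y :=
    fun x y => hasDerivAt_bandFun_snd t μ q₁ q₂ x y
  have hFfg : ∀ x y, P.integrand (pt x y) ≤ 1 / (|f x y| + |g x y|) := fun x y => by
    rw [← hfe, ← hge]; exact P.integrand_pt_le_inv x y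
  have hFgf : ∀ x y, P.integrand (pt x y) ≤ 1 / (|g x y| + |f x y|) := fun x y => by rw [add_comm]; exact hFfg x y
  -- enclosures on the closed cell
  have hX1m : ∀ x ∈ Icc ((a : ℝ) / (P.U : ℝ)) ((b : ℝ) / (P.U : ℝ)), ∀ y ∈ Icc ((c : ℝ) / (P.U : ℝ)) ((d : ℝ) / (P.U : ℝ)),
      (X1.lo : ℝ) ≤ 10 ^ 4 * 2 ^ 40 * (2 * Real.sin x * (1 + 2 * t * Real.cos y)) ∧
        10 ^ 4 * 2 ^ 40 * (2 * Real.sin x * (1 + 2 * t * Real.cos y)) ≤ (X1.hi : ℝ) :=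
    fun x hx y hy => P.tip_dx_e1_mem hP hin hdx h1 h2 hg hx.1 hx.2 hy.1 hy.2
  have hY1m : ∀ x ∈ Icc ((a : ℝ) / (P.U : ℝ)) ((b : ℝ) / (P.U : ℝ)), ∀ y ∈ Icc ((c : ℝ) / (P.U : ℝ)) ((d : ℝ) / (P.U : ℝ)),
      (Y1.lo : ℝ) ≤ 10 ^ 4 * 2 ^ 40 * (2 * Real.sin y * (1 + 2 * t * Real.cos x)) ∧
        10 ^ 4 * 2 ^ 40 * (2 * Real.sin y * (1 + 2 * t * Real.cos x)) ≤ (Y1.hi : ℝ) :=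
    fun x hx y hy => P.tip_dy_e1_mem hP hin hdy h3 h4 hg hx.1 hx.2 hy.1 hy.2
  have hX2m : ∀ x ∈ Icc ((a : ℝ) / (P.U : ℝ)) ((b : ℝ) / (P.U : ℝ)), ∀ y ∈ Icc ((c : ℝ) / (P.U : ℝ)) ((d : ℝ) / (P.U : ℝ)),
      (X2.lo : ℝ) ≤ 10 ^ 4 * 2 ^ 40 * (2 * Real.sin (x + q₁) * (1 + 2 * t * Real.cos (y + q₂))) ∧
        10 ^ 4 * 2 ^ 40 * (2 * Real.sin (x + q₁) * (1 + 2 * t * Real.cos (y + q₂))) ≤ (X2.hi : ℝ) :=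
    fun x hx y hy => P.tip_dx_e2_mem hP hin hdx' h5 h6 hg hx.1 hx.2 hy.1 hy.2
  have hY2m : ∀ x ∈ Icc ((a : ℝ) / (P.U : ℝ)) ((b : ℝ) / (P.U : ℝ)), ∀ y ∈ Icc ((c : ℝ) / (P.U : ℝ)) ((d : ℝ) / (P.U : ℝ)),
      (Y2.lo : ℝ) ≤ 10 ^ 4 * 2 ^ 40 * (2 * Real.sin (y + q₂) * (1 + 2 * t * Real.cos (x + q₁))) ∧
        10 ^ 4 * 2 ^ 40 * (2 * Real.sin (y + q₂) * (1 + 2 * t * Real.cos (x + q₁))) ≤ (Y2.hi : ℝ) :=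
    fun x hx y hy => P.tip_dy_e2_mem hP hin hdy' h7 h8 hg hx.1 hx.2 hy.1 hy.2
  have hU1m : ∀ x ∈ Icc ((a : ℝ) / (P.U : ℝ)) ((b : ℝ) / (P.U : ℝ)), ∀ y ∈ Icc ((c : ℝ) / (P.U : ℝ)) ((d : ℝ) / (P.U : ℝ)),
      |f x y| ≤ ((U1 : ℤ) : ℝ) / 2 ^ 40 := fun x hx y hy => by rw [← hfe]; exact P.tip_e1_abs_le hP hin hg hx.1 hx.2 hy.1 hy.2
  have hU2m : ∀ x ∈ Icc ((a : ℝ) / (P.U : ℝ)) ((b : ℝ) / (P.U : ℝ)), ∀ y ∈ Icc ((c : ℝ) / (P.U : ℝ)) ((d : ℝ) / (P.U : ℝ)),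
      |g x y| ≤ ((U2 : ℤ) : ℝ) / 2 ^ 40 := fun x hx y hy => by rw [← hge]; exact P.tip_e2_abs_le hP hin hg hx.1 hx.2 hy.1 hy.2
  -- the cross-slice bounds in the two directions and the two orders
  have hκ0 : 0 ≤ ((J0 : ℤ) : ℝ) / (2 * (10 ^ 4 * 2 ^ 40) * ((Lmax : ℤ) : ℝ)) := by
    have : (0 : ℝ) ≤ ((J0 : ℤ) : ℝ) := by exact_mod_cast (IV.absLo_nonneg _)
    have : (0 : ℝ) < ((Lmax : ℤ) : ℝ) := by exact_mod_cast hL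
    positivity
  have hlowX : ∀ x ∈ Icc ((a : ℝ) / (P.U : ℝ)) ((b : ℝ) / (P.U : ℝ)), ∀ y ∈ Icc ((c : ℝ) / (P.U : ℝ)) ((d : ℝ) / (P.U : ℝ)),
      ((J0 : ℤ) : ℝ) / (2 * (10 ^ 4 * 2 ^ 40) * ((Lmax : ℤ) : ℝ)) * |x - x'| ≤ |f x y| + |g x y| := by
    intro x hx y hy
    have h := hpk x hx y hy
    rw [hκeq, hfe, hge] at h
    exact le_trans (mul_le_mul_of_nonneg_left (le_max_left _ _) hκ0) h
  have hlowY : ∀ x ∈ Icc ((a : ℝ) / (P.U : ℝ)) ((b : ℝ) / (P.U : ℝ)), ∀ y ∈ Icc ((c : ℝ) / (P.U : ℝ)) ((d : ℝ) / (P.U : ℝ)),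
      ((J0 : ℤ) : ℝ) / (2 * (10 ^ 4 * 2 ^ 40) * ((Lmax : ℤ) : ℝ)) * |y - y'| ≤ |f x y| + |g x y| := by
    intro x hx y hy
    have h := hpk x hx y hy
    rw [hκeq, hfe, hge] at h
    exact le_trans (mul_le_mul_of_nonneg_left (le_max_right _ _) hκ0) h
  have hlowX' : ∀ x ∈ Icc ((a : ℝ) / (P.U : ℝ)) ((b : ℝ) / (P.U : ℝ)), ∀ y ∈ Icc ((c : ℝ) / (P.U : ℝ)) ((d : ℝ) / (P.U : ℝ)),
      ((J0 : ℤ) : ℝ) / (2 * (10 ^ 4 * 2 ^ 40) * ((Lmax : ℤ) : ℝ)) * |x - x'| ≤ |g x y| + |f x y| :=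
    fun x hx y hy => by rw [add_comm]; exact hlowX x hx y hy
  have hlowY' : ∀ x ∈ Icc ((a : ℝ) / (P.U : ℝ)) ((b : ℝ) / (P.U : ℝ)), ∀ y ∈ Icc ((c : ℝ) / (P.U : ℝ)) ((d : ℝ) / (P.U : ℝ)),
      ((J0 : ℤ) : ℝ) / (2 * (10 ^ 4 * 2 ^ 40) * ((Lmax : ℤ) : ℝ)) * |y - y'| ≤ |g x y| + |f x y| :=
    fun x hx y hy => by rw [add_comm]; exact hlowY x hx y hy
  -- strictness of the orientations comes from `tipVariant` itself; the four validity facts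
  have V1 : ∀ w, P.tipVariant Y1.absLo (max |Y2.lo| |Y2.hi|) (b - a)
      (logUpZ (cdivZ (4 * U1 * Lmax * P.U * 10 ^ 4 * D) (J0 * (b - a))) + D) = some w → P.CeilValid a b c d w := by
    intro w hw
    have hab' : a < b := by have := (P.tipVariant_eq_some hw).2.2.1; omega
    exact P.tip_valid_outer_x hP hab' hcd hfy hgy hFfg Y1 Y2 hY1m hY2m U1 hU1m J0 Lmax hJ0 hL hlowX hw
  have V2 : ∀ w, P.tipVariant X1.absLo (max |X2.lo| |X2.hi|) (d - c)
      (logUpZ (cdivZ (4 * U1 * Lmax * P.U * 10 ^ 4 * D) (J0 * (d - c))) + D) = some w → P.CeilValid a b c d w := by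
    intro w hw
    have hcd' : c < d := by have := (P.tipVariant_eq_some hw).2.2.1; omega
    exact P.tip_valid_outer_y hP hab hcd' hfx hgx hFfg X1 X2 hX1m hX2m U1 hU1m J0 Lmax hJ0 hL hlowY hw
  have V3 : ∀ w, P.tipVariant Y2.absLo (max |Y1.lo| |Y1.hi|) (b - a)
      (logUpZ (cdivZ (4 * U2 * Lmax * P.U * 10 ^ 4 * D) (J0 * (b - a))) + D) = some w → P.CeilValid a b c d w := by
    intro w hw
    have hab' : a < b := by have := (P.tipVariant_eq_some hw).2.2.1; omega
    exact P.tip_valid_outer_x hP hab' hcd hgy hfy hFgf Y2 Y1 hY2m hY1m U2 hU2m J0 Lmax hJ0 hL hlowX' hw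
  have V4 : ∀ w, P.tipVariant X2.absLo (max |X1.lo| |X1.hi|) (d - c)
      (logUpZ (cdivZ (4 * U2 * Lmax * P.U * 10 ^ 4 * D) (J0 * (d - c))) + D) = some w → P.CeilValid a b c d w := by
    intro w hw
    have hcd' : c < d := by have := (P.tipVariant_eq_some hw).2.2.1; omega
    exact P.tip_valid_outer_y hP hab hcd' hgx hfx hFgf X2 X1 hX2m hX1m U2 hU2m J0 Lmax hJ0 hL hlowY' hw
  -- finish: case on the four variants
  rcases hr1 : P.tipVariant Y1.absLo (max |Y2.lo| |Y2.hi|) (b - a)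
      (logUpZ (cdivZ (4 * U1 * Lmax * P.U * 10 ^ 4 * D) (J0 * (b - a))) + D) with _ | w1 <;>
  rcases hr2 : P.tipVariant X1.absLo (max |X2.lo| |X2.hi|) (d - c)
      (logUpZ (cdivZ (4 * U1 * Lmax * P.U * 10 ^ 4 * D) (J0 * (d - c))) + D) with _ | w2 <;>
  rcases hr3 : P.tipVariant Y2.absLo (max |Y1.lo| |Y1.hi|) (b - a)
      (logUpZ (cdivZ (4 * U2 * Lmax * P.U * 10 ^ 4 * D) (J0 * (b - a))) + D) with _ | w3 <;>
  rcases hr4 : P.tipVariant X2.absLo (max |X1.lo| |X1.hi|) (d - c)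
      (logUpZ (cdivZ (4 * U2 * Lmax * P.U * 10 ^ 4 * D) (J0 * (d - c))) + D) with _ | w4 <;>
  simp only [hr1, hr2, hr3, hr4] at h hbest <;>
  first
  | (exact absurd hbest (lt_irrefl _))
  | skip
  all_goals
    subst h
    have big_or : ∀ X : ℤ, (X = (2 : ℤ) ^ 200 ∨ P.CeilValid a b c d X) → X < 2 ^ 200 → P.CeilValid a b c d X :=
      fun X hX hlt => hX.resolve_left (ne_of_lt hlt)
    apply big_or _ _ hbest
  -- each remaining goal: `min … = big ∨ CeilValid (min …)`
  all_goals
    first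
    | exact P.ceilValid_min_or (V4 _ hr4) (P.ceilValid_min_or (V3 _ hr3) (P.ceilValid_min_or (V2 _ hr2) (P.ceilValid_min_or (V1 _ hr1) (Or.inl rfl))))
    | exact P.ceilValid_min_or (V4 _ hr4) (P.ceilValid_min_or (V3 _ hr3) (P.ceilValid_min_or (V2 _ hr2) (Or.inl rfl)))
    | exact P.ceilValid_min_or (V4 _ hr4) (P.ceilValid_min_or (V3 _ hr3) (P.ceilValid_min_or (V1 _ hr1) (Or.inl rfl)))
    | exact P.ceilValid_min_or (V4 _ hr4) (P.ceilValid_min_or (V3 _ hr3) (Or.inl rfl))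
    | exact P.ceilValid_min_or (V4 _ hr4) (P.ceilValid_min_or (V2 _ hr2) (P.ceilValid_min_or (V1 _ hr1) (Or.inl rfl)))
    | exact P.ceilValid_min_or (V4 _ hr4) (P.ceilValid_min_or (V2 _ hr2) (Or.inl rfl))
    | exact P.ceilValid_min_or (V4 _ hr4) (P.ceilValid_min_or (V1 _ hr1) (Or.inl rfl))
    | exact P.ceilValid_min_or (V4 _ hr4) (Or.inl rfl)
    | exact P.ceilValid_min_or (V3 _ hr3) (P.ceilValid_min_or (V2 _ hr2) (P.ceilValid_min_or (V1 _ hr1) (Or.inl rfl)))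
    | exact P.ceilValid_min_or (V3 _ hr3) (P.ceilValid_min_or (V2 _ hr2) (Or.inl rfl))
    | exact P.ceilValid_min_or (V3 _ hr3) (P.ceilValid_min_or (V1 _ hr1) (Or.inl rfl))
    | exact P.ceilValid_min_or (V3 _ hr3) (Or.inl rfl)
    | exact P.ceilValid_min_or (V2 _ hr2) (P.ceilValid_min_or (V1 _ hr1) (Or.inl rfl))
    | exact P.ceilValid_min_or (V2 _ hr2) (Or.inl rfl)
    | exact P.ceilValid_min_or (V1 _ hr1) (Or.inl rfl)

end Summit.HubbardSuperconductivity.HubbardSuperconductivity.Theorems.KlLindhardEnclosure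

end
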